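import Literature.NumberTheory.Automorphic.BrandtTraceNonEmbedding
import HarnessLib

/-!
# Eichler's trace formula for `tr B(n; p, M)` in Eichler–Selberg form

Topic `NumberTheory/Automorphic`; theorems only (no named fact, no `sorry`).  The capstone of
the Brandt-module side of the Eichler–Pizer trace identity: for a Brandt setup `S` of level
`(M, p)` with `M` squarefree and `p ∤ M`, granting Eichler's mass formula
(`brandtModule_massFormula`), for all `n ≥ 1` prime to `Mp`

`tr B(n) = δ(n = □) (p - 1) ψ(M)/12 + ½ Σ_{t² < 4n} Σ_f h_w((t² - 4n)/f²) μ_M(t, f, n) (2 - μ_p(t, f, n))`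

(`XiSetup.trace_matrix_eq_eichlerSelberg`) — the hypothesis `hB` of
`traceIdentity_of_traceFormulas` — by assembling the mass term, the optimal-embedding count of
the elliptic terms (`XiSetup.sum_card_traceNormSet_div_eq_sum_hw_br`, and its vanishing at
non-embeddable `(t, n)`, `XiSetup.sum_hw_br_eq_zero_of_forall`), the resummation
`Σ h_w ∏ μ = Σ h_w ∏ m` (`sum_hw_es_eq_sum_hw_br`) and the evaluation of the Eichler–Selberg
local densities at squarefree level (`localDensity_squarefree_one_eq`).  (Takahashi's
`rank L = 1` granting the Eichler–Selberg trace formula and the mass formula follows in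
`EllipticCurves/TakahashiRankOneOfTraceFormula.lean`.)

## References

* M. Eichler, *Zur Zahlentheorie der Quaternionen-Algebren*, J. reine angew. Math. 195 (1955),
  (the trace formula for Brandt matrices), [Eichler1955].
* A. Pizer, *Theta series and modular forms of level `p²M`*, Compositio Math. 40 (1980),
  Thm. 2.25 (2.8), [Pizer1980].
* R. Schoof, M. van der Vlugt, *Hecke operators and the weight distributions of certain codes*,
  JCTA 57 (1991), Thm. 2.2, [SchoofVandervlugt1991].
-/

noncomputable section

open Finset

namespace Literature.NumberTheory.Automorphic

open HeckeTraceFormulaGL2Level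

namespace Brandt

/-! ### The Eichler–Selberg local densities at prime and squarefree level -/

section LocalDensity

variable {t : ℤ} {n : ℕ}

/-- **`ψ(M) = ∏_{q ∣ M} (q + 1)` for squarefree `M`.** [cite: SchoofVandervlugt1991, Thm. 2.2 (ψ)] -/
theorem dedekindPsi_squarefree {M : ℕ} (hsq : Squarefree M) :
    dedekindPsi M = ∏ q ∈ M.primeFactors, ((q : ℚ) + 1) := by
  have key : ∀ s : Finset ℕ, (∀ q ∈ s, q.Prime) → dedekindPsi (∏ q ∈ s, q) = ∏ q ∈ s, ((q : ℚ) + 1) := by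
    intro s
    induction s using Finset.induction_on with
    | empty => intro _; rw [Finset.prod_empty, Finset.prod_empty, dedekindPsi_one]
    | insert a s ha ih =>
      intro hs
      have hap : a.Prime := hs a (Finset.mem_insert_self _ _)
      have hs' : ∀ q ∈ s, q.Prime := fun q hq => hs q (Finset.mem_insert_of_mem hq)
      have hne : (∏ q ∈ s, q) ≠ 0 := Finset.prod_ne_zero_iff.mpr fun q hq => (hs' q hq).ne_zero
      have hnd : ¬ a ∣ ∏ q ∈ s, q := by
        intro hd
        obtain ⟨q, hq, hqa⟩ := (Prime.dvd_finsetProd_iff (Nat.prime_iff.mp hap) _).mp hd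
        exact ha (((Nat.prime_dvd_prime_iff_eq hap (hs' q hq)).mp hqa) ▸ hq)
      rw [Finset.prod_insert ha, Finset.prod_insert ha, mul_comm a, dedekindPsi_mul_prime hne hap hnd, ih hs', mul_comm]
  have := key M.primeFactors fun q hq => Nat.prime_of_mem_primeFactors hq
  rwa [Nat.prod_primeFactors_of_squarefree hsq] at this

/-- **The local density at level `1` is `1`.** [cite: SchoofVandervlugt1991, Thm. 2.2 (μ(t, f, n))] -/
theorem localDensity_one_one (t : ℤ) (f n : ℕ) : localDensity 1 1 t f n = 1 := by
  unfold localDensity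
  have h1 : (1 : DirichletCharacter ℂ 1) (0 : ZMod 1) = 1 := MulChar.one_apply (isUnit_of_subsingleton _)
  simp [h1]

/-- A root of `x² - tx + n` modulo a prime `q ∤ n` is a unit modulo `q`. [folklore] -/
theorem isUnit_of_dvd_quad {q : ℕ} [hq : Fact q.Prime] (hn : n.Coprime q) {x : ZMod q}
    (hx : (q : ℤ) ∣ (x.val : ℤ) ^ 2 - t * x.val + n) : IsUnit x := by
  rw [isUnit_iff_ne_zero]
  rintro rfl
  rw [ZMod.val_zero] at hx
  simp only [Nat.cast_zero, ne_eq, OfNat.ofNat_ne_zero, not_false_eq_true, zero_pow, mul_zero, sub_self,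
    zero_add, Int.natCast_dvd_natCast] at hx
  have := Nat.Coprime.eq_one_of_dvd (Nat.Coprime.symm hn) hx
  exact hq.out.one_lt.ne' this

/-- **The local density at a prime level**: `μ_q(t, f, n) = q + 1` if `q ∣ f`, `ρ_q(t, n)`
otherwise (`(n, q) = 1`, `f` a conductor). [cite: SchoofVandervlugt1991, Thm. 2.2 (μ(t, f, n))] -/
theorem localDensity_prime_one_eq {q : ℕ} (hq : q.Prime) (hn : n.Coprime q) (h : t ^ 2 < 4 * n) {f : ℕ}
    (hf : f ∈ ellipticConductors t n) :
    haveI : NeZero q := ⟨hq.ne_zero⟩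
    localDensity q 1 t f n = ((esFactor q t n f : ℚ) : ℂ) := by
  classical
  haveI := Fact.mk hq
  haveI : NeZero q := ⟨hq.ne_zero⟩
  rw [localDensity_one_eq_card, esFactor]
  have hψ : dedekindPsi q ≠ 0 := (dedekindPsi_pos hq.ne_zero).ne'
  by_cases hqf : q ∣ f
  · rw [if_pos hqf, Nat.gcd_eq_left hqf, Nat.div_self hq.pos, dedekindPsi_prime hq, dedekindPsi_one, div_one]
    -- exactly one (unit) solution modulo `q` of `q² ∣ x² - tx + n`
    have hcard : (Finset.univ.filter fun x : ZMod q =>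
        ((q * q : ℕ) : ℤ) ∣ (x.val : ℤ) ^ 2 - t * x.val + n ∧ IsUnit x).card = 1 := by
      rw [← card_sq_dvd_eq_one h hq hf hqf]
      symm
      refine Finset.card_bij (fun x _ => (x : ZMod q)) (fun x hx => ?_) (fun x hx y hy hxy => ?_) (fun y hy => ?_)
      · rw [Finset.mem_filter, Finset.mem_range] at hx
        rw [Finset.mem_filter]
        have hv : (x : ZMod q).val = x := ZMod.val_cast_of_lt hx.1
        refine ⟨Finset.mem_univ _, by rw [hv]; exact hx.2, isUnit_of_dvd_quad (t := t) hn ?_⟩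
        rw [hv]
        exact (Int.natCast_dvd_natCast.mpr (dvd_mul_right q q) : (q : ℤ) ∣ ((q * q : ℕ) : ℤ)).trans hx.2
      · have h₁ := Finset.mem_range.mp (Finset.mem_filter.mp hx).1
        have h₂ := Finset.mem_range.mp (Finset.mem_filter.mp hy).1
        have := congrArg ZMod.val hxy
        rwa [ZMod.val_cast_of_lt h₁, ZMod.val_cast_of_lt h₂] at this
      · refine ⟨y.val, ?_, ZMod.natCast_zmod_val y⟩
        rw [Finset.mem_filter, Finset.mem_range]
        exact ⟨ZMod.val_lt y, (Finset.mem_filter.mp hy).2.1⟩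
    rw [hcard]; push_cast; ring
  · rw [if_neg hqf, (hq.coprime_iff_not_dvd.mpr hqf).gcd_eq_one, Nat.div_one, div_self hψ]
    have hcard : (Finset.univ.filter fun x : ZMod q =>
        ((q * 1 : ℕ) : ℤ) ∣ (x.val : ℤ) ^ 2 - t * x.val + n ∧ IsUnit x).card = rho q t n := by
      rw [rho_eq_card_zmod]
      refine Finset.card_bij (fun x _ => x) (fun x hx => ?_) (fun x _ y _ hxy => hxy) (fun y hy => ⟨y, ?_, rfl⟩)
      · rw [Finset.mem_filter] at hx ⊢
        refine ⟨Finset.mem_univ _, ?_⟩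
        have := (dvd_quad_iff_zmod t n x.val).mp (by simpa using hx.2.1)
        simpa [ZMod.natCast_zmod_val] using this
      · rw [Finset.mem_filter] at hy ⊢
        have hd : (q : ℤ) ∣ (y.val : ℤ) ^ 2 - t * y.val + n := by
          rw [dvd_quad_iff_zmod t n y.val]; simpa [ZMod.natCast_zmod_val] using hy.2
        exact ⟨Finset.mem_univ _, by simpa using hd, isUnit_of_dvd_quad hn hd⟩
    rw [hcard]; push_cast; ring

/-- **The local density at a squarefree level is the product of the prime local densities.** [cite: SchoofVandervlugt1991, Thm. 2.2 (μ(t, f, n)); multiplicativity] -/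
theorem localDensity_squarefree_one_eq {M : ℕ} [NeZero M] (hsq : Squarefree M) (hn : n.Coprime M)
    (h : t ^ 2 < 4 * n) {f : ℕ} (hf : f ∈ ellipticConductors t n) :
    localDensity M 1 t f n = ((∏ q ∈ M.primeFactors, esFactor q t n f : ℚ) : ℂ) := by
  have hfΔ : (f : ℤ) ^ 2 ∣ t ^ 2 - 4 * n := sq_dvd_of_mem_ellipticConductors hf
  have key : ∀ (s : Finset ℕ), (∀ q ∈ s, q.Prime) → (∀ q ∈ s, n.Coprime q) →
      ∀ (N : ℕ) [NeZero N], N = ∏ q ∈ s, q → localDensity N 1 t f n = ((∏ q ∈ s, esFactor q t n f : ℚ) : ℂ) := by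
    intro s
    induction s using Finset.induction_on with
    | empty =>
      intro _ _ N _ hN
      rw [Finset.prod_empty] at hN
      subst hN
      rw [localDensity_one_one]; simp
    | insert a s ha ih =>
      intro hs hns N _ hN
      have hap : a.Prime := hs a (Finset.mem_insert_self _ _)
      have hs' : ∀ q ∈ s, q.Prime := fun q hq => hs q (Finset.mem_insert_of_mem hq)
      have hns' : ∀ q ∈ s, n.Coprime q := fun q hq => hns q (Finset.mem_insert_of_mem hq)
      haveI : NeZero (∏ q ∈ s, q) := ⟨Finset.prod_ne_zero_iff.mpr fun q hq => (hs' q hq).ne_zero⟩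
      haveI : NeZero a := ⟨hap.ne_zero⟩
      have hcop : (∏ q ∈ s, q).Coprime a := by
        refine Nat.Coprime.symm ((Nat.Prime.coprime_iff_not_dvd hap).mpr fun hd => ?_)
        obtain ⟨q, hq, hqa⟩ := (Prime.dvd_finsetProd_iff (Nat.prime_iff.mp hap) _).mp hd
        exact ha (((Nat.prime_dvd_prime_iff_eq hap (hs' q hq)).mp hqa) ▸ hq)
      rw [Finset.prod_insert ha, mul_comm] at hN
      subst hN
      rw [localDensity_one_mul hcop hfΔ, ih hs' hns' _ rfl, localDensity_prime_one_eq hap (hns a (Finset.mem_insert_self _ _)) h hf,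
        Finset.prod_insert ha]
      push_cast; ring
  exact key M.primeFactors (fun q hq => Nat.prime_of_mem_primeFactors hq)
    (fun q hq => hn.coprime_dvd_right (Nat.dvd_of_mem_primeFactors hq)) M
    (Nat.prod_primeFactors_of_squarefree hsq).symm

end LocalDensity

/-! ### The mass term -/

section Mass

variable {M p : ℕ}

/-- **The mass of a Brandt setup of level `(M, p)`** (`M` squarefree), granting Eichler's mass
formula: `Σ_i 1/w_i = (p - 1) ψ(M)/12`. [cite: VignerasLNM800, Ch. V §2 Cor. 2.3] -/
theorem XiSetup.sum_inv_weight_eq (S : XiSetup M p) [Fintype (ClassSet S.O)] (hM : M ≠ 0) (hsq : Squarefree M)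
    (hp : p.Prime) (hmass : brandtModule_massFormula) :
    ∑ i, (1 : ℚ) / weight S.O i = ((p : ℚ) - 1) * dedekindPsi M / 12 := by
  classical
  have h := hmass M p S.toEichlerPackage (Nat.pos_of_ne_zero hM) hp.squarefree
  -- the two index types and weights agree
  have hO : IsZOrder S.toEichlerPackage.O := S.toEichlerPackage.isEichlerOrder.isZOrder
  have hri := rightIdeals_eq_invertibleRightIdeals_of_isTotallyDefinite S.isTotallyDefinite hO
  let e : ClassSet S.O ≃ S.toEichlerPackage.brandtData.ι := ClassSet.equivRightIdealClass hri
  have hsum : ∑ i : S.toEichlerPackage.brandtData.ι, (1 : ℚ) / S.toEichlerPackage.brandtData.w i =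
      ∑ i : ClassSet S.O, (1 : ℚ) / weight S.O i := by
    rw [← Fintype.sum_equiv e (fun i => (1 : ℚ) / weight S.O i) (fun j => (1 : ℚ) / S.toEichlerPackage.brandtData.w j)
      (fun i => by rw [show S.toEichlerPackage.brandtData.w (e i) = weight S.O i from
        BrandtData.ofOrder_w_equivRightIdealClass _ hri i])]
  rw [← hsum, h, hp.primeFactors, Finset.prod_singleton, dedekindPsi_squarefree hsq]
  have hexp : ∀ q ∈ M.primeFactors, (q : ℚ) ^ (M.factorization q - 1) * ((q : ℚ) + 1) = (q : ℚ) + 1 := by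
    intro q hq
    have h1 : M.factorization q = 1 := le_antisymm (hsq.natFactorization_le_one q)
      (((Nat.prime_of_mem_primeFactors hq).dvd_iff_one_le_factorization hM).mp (Nat.dvd_of_mem_primeFactors hq))
    rw [h1]; simp
  rw [Finset.prod_congr rfl hexp]
  ring

end Mass

/-! ### The trace formula -/

section Trace

variable {M p : ℕ}

/-- **The `t`-th elliptic term**: for `t² < 4n`, `(n, Mp) = 1`,
`Σ_i #{x ∈ O_L(I_i) : (trd, nrd)(x) = (t, n)}/(2wᵢ) = ½ Σ_f h_w((t² - 4n)/f²) μ_M(t,f,n) (2 - μ_p(t,f,n))`. [cite: Eichler1955, §8; Pizer1980, Thm. 2.25 (2.8)] -/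
theorem XiSetup.ellipticTerm_eq (S : XiSetup M p) [Fintype (ClassSet S.O)] [NeZero M] (hsq : Squarefree M)
    (hp : p.Prime) (hpM : ¬ p ∣ M) {n : ℕ} (hn : n.Coprime (M * p)) {t : ℤ} (ht : t ^ 2 < 4 * n) :
    ((∑ i, (Nat.card (traceNormSet i.rep (t : ℚ) (n : ℚ)) : ℚ) / (2 * weight S.O i) : ℚ) : ℂ) =
      (1 / 2 : ℂ) * ∑ f ∈ ellipticConductors t n,
        (weightedClassNumber ((t ^ 2 - 4 * n) / (f : ℤ) ^ 2) : ℂ) *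
          (localDensity M 1 t f n * (2 - localDensity p 1 t f n)) := by
  have hM : M ≠ 0 := NeZero.ne M
  haveI : NeZero p := ⟨hp.ne_zero⟩
  -- the Eichler–Selberg side in terms of `esFactor`
  have hES : ∑ f ∈ ellipticConductors t n, (weightedClassNumber ((t ^ 2 - 4 * n) / (f : ℤ) ^ 2) : ℂ) *
        (localDensity M 1 t f n * (2 - localDensity p 1 t f n)) =
      ((∑ f ∈ ellipticConductors t n, hw t n f *
        ((∏ q ∈ M.primeFactors, esFactor q t n f) * (2 - esFactor p t n f)) : ℚ) : ℂ) := by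
    push_cast
    refine Finset.sum_congr rfl fun f hf => ?_
    rw [localDensity_squarefree_one_eq hsq (Nat.Coprime.coprime_mul_right_right hn) ht hf,
      localDensity_prime_one_eq hp (Nat.Coprime.coprime_mul_left_right hn) ht hf, hw]
    push_cast
    ring
  rw [hES, sum_hw_es_eq_sum_hw_br ht hp M.primeFactors (fun q hq => Nat.prime_of_mem_primeFactors hq)
    (fun h => hpM (Nat.dvd_of_mem_primeFactors h))]
  -- the Brandt side
  by_cases hex : ∃ γ : S.D, reducedTrace ℚ S.D γ = t ∧ reducedNorm ℚ S.D γ = n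
  · obtain ⟨γ, hγt, hγn⟩ := hex
    have H : GammaHyp γ t n := ⟨S.hdiv, hγt, hγn, ht⟩
    rw [S.sum_card_traceNormSet_div_eq_sum_hw_br hM hsq hp hpM H]
    push_cast; ring
  · push Not at hex
    rw [S.sum_card_traceNormSet_div_eq_zero (fun x hx => hex x hx), S.sum_hw_br_eq_zero_of_forall hp ht hex]
    push_cast; ring

/-- **Eichler's trace formula for the Brandt matrices of a setup of level `(M, p)`, `M`
squarefree, in Eichler–Selberg form** (granting the mass formula): for `n ≥ 1` prime to `Mp`,
`tr B(n) = δ(n = □)(p - 1)ψ(M)/12 + ½ Σ_{t² < 4n} Σ_f h_w((t² - 4n)/f²) μ_M(t,f,n)(2 - μ_p(t,f,n))`. [cite: Eichler1955, §8; Pizer1980, Thm. 2.25 (2.8), p. 359; VignerasLNM800, Ch. V §2 Prop. 2.4] -/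
theorem XiSetup.trace_matrix_eq_eichlerSelberg (S : XiSetup M p) [Fintype (ClassSet S.O)] [NeZero M]
    (hsq : Squarefree M) (hp : p.Prime) (hpM : ¬ p ∣ M) (hmass : brandtModule_massFormula)
    (n : ℕ) (hn0 : 0 < n) (hn : n.Coprime (M * p)) :
    (((Brandt.matrix S.O n).trace : ℤ) : ℂ) =
      (if IsSquare n then ((p : ℂ) - 1) * (dedekindPsi M : ℂ) / 12 else 0) +
        (1 / 2 : ℂ) *
          ∑ t ∈ (Finset.Icc (-(2 * n : ℤ)) (2 * n)).filter (fun t : ℤ => t ^ 2 < 4 * (n : ℤ)),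
            ∑ f ∈ ellipticConductors t n,
              (weightedClassNumber ((t ^ 2 - 4 * n) / (f : ℤ) ^ 2) : ℂ) *
                (localDensity M 1 t f n * (2 - localDensity p 1 t f n)) := by
  have hM : M ≠ 0 := NeZero.ne M
  have hQ := S.trace_matrix_eq_mass_add_sum hn0.ne'
  have hQC := congrArg (fun x : ℚ => (x : ℂ)) hQ
  beta_reduce at hQC
  push_cast at hQC
  rw [hQC, S.sum_inv_weight_eq hM hsq hp hmass, Finset.mul_sum]
  congr 1
  · split_ifs <;> push_cast <;> ring
  · refine Finset.sum_congr rfl fun t ht => ?_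
    rw [Finset.mem_filter] at ht
    have := S.ellipticTerm_eq hsq hp hpM hn ht.2
    push_cast at this
    exact this

end Trace

end Brandt

end Literature.NumberTheory.Automorphic

end
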